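import Summits.HodgeConjecture.HodgeConjecture.Theorems.Ring2AbelianAllAndreFibreClass
import Summits.HodgeConjecture.HodgeConjecture.Theorems.Ring2AbelianAllAndreGraded
import Summits.HodgeConjecture.HodgeConjecture.Theorems.WeilTypeLadderOnPath
import HarnessLib

/-!
# Ring 2 · sub-cell AbelianAll (ALL ABELIAN VARIETIES), André axis, part VII — the SMALLEST OPEN INSTANCE as a
# kernel row: compact CM-pointed WEIL pencils halve the doubling of Lemme 6.3.1, so `HC_CM` + β-Lefschetz (or
# transport) on pencils of relative dimension `2n` gives the Weil classes on abelian `2n`-folds; at `n = 3` the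
# item `WeilSixfolds` costs β-Lefschetz on SEVEN-dimensional total spaces

HONEST FRAMING (page 1, verbatim): **research route, not a corollary; conditional on HC_CM plus one named
minimal statement.** Cell line: research route conditional on HC_CM; not a corollary; Q11.4-sentence-2
already refuted in dim ≥ 3. Nothing in this file proves a case of the Hodge conjecture. `HC_CM` =
`Theses.RankFourFaces.CMAbelianHodge` (a BINDER, never cited); the targets reached are the b2b ladder's
`WeilTypeLadder.WeilClassesImaginaryQuadratic` (R∞: Weil's 1977 question for every imaginary quadratic `K`, every
`n ≥ 2`) and the item `Theses.SevenfoldWeilCensus.WeilSixfolds` (stmt-HodgeConjecture-2524) — reached CONDITIONALLY,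
nothing is closed. Seat `pub-hodge-ring2-ab-andre-2`, gen 2; brief (iii) "smallest open instance stated as a
find-the-cycle problem; partial results as theorems" (RING2-MAP AA2.3/AA2.10: the `W₆` pencil on a 7-fold).

**ERRATUM (gen 2, RING2-MAP §AbelianAll AA2.13; referee finding F-ab-32, docstring-only revision gen 4).** The
graded node `FibreClassLefschetzAtRelDim d` of §B is built on part V's per-pencil node `FibreClassLefschetzFor`,
which quantifies over ALL degrees `p` and is **REFUTED-MISSTATED** (`not_fibreClassLefschetzFor`; graded form
`not_fibreClassLefschetzAtRelDim_of_pencil`, part VIII `Ring2AbelianAllAndreFibreClassRange`): given one CM-pointed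
compact pencil of relative dimension `d` the node is FALSE, and the rows of §C taking it as a hypothesis
(`HC_weilClassesImaginaryQuadratic_of_HC_CM_of_weilPencils_of_fibreClassLefschetz`,
`HC_weilSixfolds_of_HC_CM_of_weilPencilsAt_of_fibreClassLefschetzAtRelDim_six`) are VACUOUS. **SUPERSEDED** by the
repaired graded node `FibreClassLefschetzOnAtRelDim d` (degree bound `p ≤ d`) of part VIII, where the graded edge
and both rows are re-proved (`cmAnchoredTransportAtRelDim_of_fibreClassLefschetzOnAtRelDim`,
`HC_weilSixfolds_of_HC_CM_of_weilPencilsAt_of_fibreClassLefschetzOnAtRelDim_six`), and by part IX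
`Ring2AbelianAllAndreWeilPencilsCMPower` (`HC_CM`-free Weil rows). NOT affected: §A the habitat node (W)
`CMAnchoredCompactWeilPencilsAt n`, the transport rows of §C (`…_of_transport`,
`…_of_cmAnchoredTransportAtRelDim_six`), §D. The refuted declarations are kept verbatim for the record (def bodies
are append-only).

## Why a new habitat node

Part IV (`Ring2AbelianAllAndreGraded`) priced `HC` in dimension `g` through André's Lemme 6.3.1 at relative
dimension `2g` (fibres `~ A × A`): for the first open abelian varieties — Weil-type SIXFOLDS, `W₆` — that is
relative dimension 12, a 13-fold total space. For an abelian variety that is ALREADY of Weil type the doubling is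
unnecessary in print: the Hodge-type (PEL) Shimura variety of `(A, K ↪ End⁰A, polarisation)` has hermitian
symmetric domain `SU(n,n)`, whose Baily–Borel boundary has codimension `2nk − k² ≥ 2n − 1 ≥ 3` (`n ≥ 2`, `k ≥ 1`
the dimension of an isotropic subspace), so André's construction of Lemme 6.3.1 (p. 32: "X* − X de codimension ≥ 2
… Bertini … une courbe projective lisse passant par deux points donnés", applied there to the datum of `A × A`)
yields a COMPACT curve section through the point of `A` and through a CM point (CM points exist and are dense on
every Shimura variety of Hodge type: Mumford 1969 §3, Deligne LNM 900 §5), over which the Weil class `c` —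
invariant under the derived group `SU`, hence a global flat section, of type `(n,n)` on every fibre (Weil 1977;
Deligne LNM 900 §4) — lifts to a global class of the projective total space (théorème de la partie fixe).
INFERENCE (this seat, from the cited proofs; labelled): this is a theorem-in-print-by-assembly, typed below as
the OPEN node (W) `CMAnchoredCompactWeilPencilsAt n` because none of it is formalised (no Shimura varieties in
the tree) — exactly as the transport seat typed the NON-compact `Ring2Transport.CMPointedWeilFamiliesQuadratic`.
The difference that matters for this column: on a COMPACT pencil the total space is projective, so the
Lefschetz-type node (β) of part V (an algebraic correspondence of `𝒳` inverting cup-with-the-fibre-class) makes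
sense and IMPLIES the transport (kernel, part V); on the quasi-projective Weil families it does not even parse.

## Content

* §A (W) `CMAnchoredCompactWeilPencilsAt n` — per Weil class `c ≠ 0` on a Weil-type `2n`-fold `(A, φ)`,
  `φ² = −d`: a compact pencil of relative dimension `2n` with a fibre chart `A.X ≅ 𝒳_s`, a fibrewise-Hodge global
  `W` reading `c` on `𝒳_s`, and a CM fibre. NOT a case of `HC` (HC produces cycles, not pencils): no on-path lemma.
* §B graded Lefschetz node `FibreClassLefschetzAtRelDim d` ((β) at relative dimension `d` only;
  `(β) ↔ ∀ d, …AtRelDim d`) and the graded kernel edge `FibreClassLefschetzAtRelDim d ⟹ CMAnchoredTransportAtRelDim d`.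
* §C ROWS (kernel, NO named fact): `HC_CM ∧ (W)ₙ ∧ CMAnchoredTransportAtRelDim (2n) ⟹` Weil classes at `n`
  (core lemma `mem_algebraicClasses_of_HC_CM_of_weilPencilsAt_of_transport`); hence
  `HC_CM ∧ (∀ n ≥ 2, (W)ₙ) ∧ (∀ n ≥ 2, (β) at 2n) ⟹ WeilClassesImaginaryQuadratic`
  (`HC_weilClassesImaginaryQuadratic_of_HC_CM_of_weilPencils_of_fibreClassLefschetz`) and, THE SMALLEST OPEN INSTANCE,
  **`HC_CM ∧ (W)₃ ∧ FibreClassLefschetzAtRelDim 6 ⟹ WeilSixfolds`** (`HC_weilSixfolds_of_HC_CM_of_weilPencilsAt_of_fibreClassLefschetzAtRelDim_six`):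
  find ONE algebraic correspondence on the 14-fold `𝒳 × 𝒳` of each CM-pointed compact Weil-sixfold pencil
  `𝒳⁷ → C` inverting `∪[F]` on fibre restrictions. Compare part IV's `hcAtDim_of_HC_CM_of_cmAnchoredTransportAtRelDim`
  at `g = 6`: relative dimension 12. The transport versions (without β) are recorded too.
* KIND (print): (W) is habitat existence (KIND-neutral, print-true by the inference above); `CMAnchoredTransportAtRelDim`
  / `FibreClassLefschetzAtRelDim` on CM-pointed pencils are KIND 1 in print (Lemme 6.3.3's anchor `Eᴺ` CM) and
  `HC_CM`-load-bearing in the kernel — as in parts I–V.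

References: Andre1996Motifs (Lemme 6.3.1 and its proof, pp. 31–32; Remarque 2); Deligne1982HodgeCycles (§4 Weil type,
proof of Thm. 4.8; §5 CM points); Mumford1969NoteShimura (§3); Weil1977HodgeRing; Milne2020HodgeClassesAV (Rem. 3:
"boundary of codimension at least 2 … except for components of dimension 1"); Abdulali1994FamiliesAV (Conj. 5.3, Lemma
6.2); BailyBorel1966 (compactification); vanGeemen1994HodgeAV (4.9–4.12: Weil classes are of type (n,n)).
-/

noncomputable section

set_option linter.dupNamespace false

namespace Summit.HodgeConjecture.HodgeConjecture.Ring2.AbelianAll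

open CategoryTheory AlgebraicGeometry
open Literature.AlgebraicGeometry Literature.AlgebraicGeometry.Motives
open Literature.AlgebraicGeometry.HodgeTheory
open Literature.AlgebraicGeometry.Milne1999 (IsOfCMType)
open Literature.AlgebraicGeometry.Deligne1982 (cmLocus)
open Summit.HodgeConjecture.HodgeConjecture
open Summit.HodgeConjecture.HodgeConjecture.Theses
open Summit.HodgeConjecture.HodgeConjecture.WeilTypeLadder (WeilClassesImaginaryQuadratic
  weilSixfolds_iff_weilClassesOf)

variable {𝒳 S : SchemeOver ℂ}

/-! ## §A The habitat node: compact CM-pointed Weil pencils (no doubling) -/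

/-- **(W)ₙ `CMAnchoredCompactWeilPencilsAt n` — every non-zero Weil class on an abelian `2n`-fold of Weil type
sits on a COMPACT CM-pointed pencil of relative dimension `2n`.** For `0 < d`, `(A, φ)` with `dim A = 2n`,
`φ ≫ φ = -(d • 𝟙 A)` (so `K = ℚ(√-d) ↪ End⁰ A`), and a rational `(n,n)` class `c ≠ 0` in the Weil plane
`weilClassesOf A φ n d`: there are a compact pencil of abelian varieties `f : 𝒳 ⟶ S` of relative dimension `2n`
(`IsCompactAbelianPencil`), points `s, t`, a global `W ∈ H^{2n}(𝒳(ℂ); ℂ)` rational of type `(n,n)` on every fibre,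
a chart `e₁ : A.X ≅ 𝒳_s` with `e₁^*(W|_{𝒳_s}) = c`, and a CM abelian variety `A₀` with `A₀.X ≅ 𝒳_t`. In print: a
compact curve section of the `SU(n,n)` Shimura variety of `(A, K, polarisation)` through `A` and a CM point
(Baily–Borel boundary of codimension `≥ 2n − 1 ≥ 3` for `n ≥ 2`; Bertini — André's proof of Lemme 6.3.1, p. 32,
run on the Weil datum instead of `A × A`; CM points: Mumford 1969 §3), the `SU`-invariant Weil section lifted to
the projective total space by the théorème de la partie fixe — an INFERENCE from the cited proofs, NOT formalised
(no Shimura varieties in the tree): OPEN as a statement of the tree; a HYPOTHESIS wherever used. NOT a case of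
`HC` (it asserts a habitat, not a cycle); no on-path lemma. Halves part IV's relative dimension `4n` for Weil
classes; the print argument needs `n ≥ 2` and the rows below use (W)ₙ only for `n ≥ 2` (nothing is claimed at `n = 1`).
[cite: Andre1996Motifs, Lemme 6.3.1 and proof (pp. 31–32)] [cite: Deligne1982HodgeCycles, §4 (proof of Thm. 4.8) and §5]
[cite: Mumford1969NoteShimura, §3] [cite: Milne2020HodgeClassesAV, Rem. 3 (p. 8)] -/
@[conjecture] def CMAnchoredCompactWeilPencilsAt (n : ℕ) : Prop :=
  ∀ (d : ℕ), 0 < d → ∀ (A : AbelianVariety ℂ) (φ : A ⟶ A), A.dim = 2 * n →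
    IsSmoothProjective (2 * n) A.X → φ ≫ φ = -(d • 𝟙 A) →
      ∀ c : complexBetti A.X (2 * n), IsRationalClass c → IsOfHodgeType (2 * n) A.X (2 * n) n n c →
        c ∈ weilClassesOf A φ n d → c ≠ 0 →
        ∃ (𝒳 S : SchemeOver ℂ) (f : 𝒳 ⟶ S), IsCompactAbelianPencil f (2 * n) ∧
          ∃ (s t : ComplexPoints S) (W : complexBetti 𝒳 (2 * n)) (e₁ : A.X ≅ fiberOver f s) (A₀ : AbelianVariety ℂ),
            (∀ s' : ComplexPoints S, IsRationalClass (complexBetti.map (fiberι f s') (2 * n) W) ∧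
              IsOfHodgeType (2 * n) (fiberOver f s') (2 * n) n n (complexBetti.map (fiberι f s') (2 * n) W)) ∧
            complexBetti.map e₁.hom (2 * n) (complexBetti.map (fiberι f s) (2 * n) W) = c ∧
            Nonempty (A₀.X ≅ fiberOver f t) ∧ IsOfCMType A₀

/-! ## §B The graded Lefschetz node and its graded edge -/

/-- **`FibreClassLefschetzAtRelDim d` — part V's (β) (`FibreClassLefschetzCMPointedPencils`) on compact pencils of
relative dimension `d` ONLY**: every compact pencil of abelian `d`-folds with a CM fibre satisfies β-Lefschetz
(`FibreClassLefschetzFor`). OPEN (for `d ≥ 4`-ish); a HYPOTHESIS wherever used; `(β) ↔ ∀ d, …AtRelDim d`.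
**ERRATUM: REFUTED-MISSTATED (unbounded `p` in `FibreClassLefschetzFor`; false given one CM-pointed compact pencil of
relative dimension `d`, `not_fibreClassLefschetzAtRelDim_of_pencil`, part VIII); SUPERSEDED by
`FibreClassLefschetzOnAtRelDim d` of part VIII `Ring2AbelianAllAndreFibreClassRange`. Kept for the record.**
[cite: Abdulali1994FamiliesAV, Conjecture 5.3 (p. 1130)] [cite: Andre1996Motifs, Remarque 2 (p. 33)] -/
@[conjecture] def FibreClassLefschetzAtRelDim (d : ℕ) : Prop :=
  ∀ ⦃𝒳 S : SchemeOver ℂ⦄ ⦃f : 𝒳 ⟶ S⦄ (hf : IsCompactAbelianPencil f d), (cmLocus f d).Nonempty →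
    FibreClassLefschetzFor hf

/-- (β) is the conjunction of its graded pieces. [folklore] -/
theorem fibreClassLefschetzCMPointedPencils_iff_forall_atRelDim :
    FibreClassLefschetzCMPointedPencils ↔ ∀ d : ℕ, FibreClassLefschetzAtRelDim d :=
  ⟨fun h _ _ _ _ hf hcm ↦ h hf hcm, fun h _ _ _ _ hf hcm ↦ h _ hf hcm⟩

/-- **Graded kernel edge: `FibreClassLefschetzAtRelDim d ⟹ CMAnchoredTransportAtRelDim d`** (part V's engine
`exists_algebraic_lift_of_fibreClassLefschetzFor` at the CM fibre, then part I's `map_fiberι_mem_algebraicClasses_of_lift`).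
NO named fact. [cite: Abdulali1994FamiliesAV, Theorem 5.5 (p. 1130)] -/
theorem cmAnchoredTransportAtRelDim_of_fibreClassLefschetzAtRelDim {d : ℕ} (h : FibreClassLefschetzAtRelDim d) :
    CMAnchoredTransportAtRelDim d := by
  intro 𝒳 S f hf p W _ t ht h₀ s
  obtain ⟨η, hη, hηs⟩ := exists_algebraic_lift_of_fibreClassLefschetzFor hf (h hf ⟨t, ht⟩) W h₀
  exact map_fiberι_mem_algebraicClasses_of_lift hf hη (hηs s) s

/-! ## §C The rows: Weil classes from `HC_CM`, compact Weil pencils and the input at relative dimension `2n` -/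

/-- **Core lemma.** Under `HC_CM`, (W)ₙ and transport out of CM fibres on compact pencils of relative dimension
`2n` (`CMAnchoredTransportAtRelDim (2n)`, part IV), every rational `(n,n)` Weil class on an abelian `2n`-fold of
Weil type (`φ² = −d`) is algebraic: (W)ₙ supplies the pencil, `HC_CM` makes `W|_{𝒳_t}` algebraic on the CM fibre
(`Ring2Transport.mem_algebraicClasses_of_cmChart`, the ONLY use of `HC_CM`), the transport input carries it to
`𝒳_s ≅ A.X`, and the chart reads `c`. NO named fact. research route, not a corollary; conditional on HC_CM plus one
named minimal statement. [cite: Andre1996Motifs, §6.3 a) (p. 33)] [cite: Abdulali1994FamiliesAV, Lemma 6.2 (p. 1131)] -/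
theorem mem_algebraicClasses_of_HC_CM_of_weilPencilsAt_of_transport {n : ℕ} (hCM : RankFourFaces.CMAbelianHodge)
    (hW : CMAnchoredCompactWeilPencilsAt n) (hT : CMAnchoredTransportAtRelDim (2 * n))
    {d : ℕ} (hd : 0 < d) {A : AbelianVariety ℂ} {φ : A ⟶ A} (hAdim : A.dim = 2 * n)
    (hA : IsSmoothProjective (2 * n) A.X) (hφ : φ ≫ φ = -(d • 𝟙 A)) {c : complexBetti A.X (2 * n)}
    (hcQ : IsRationalClass c) (hcH : IsOfHodgeType (2 * n) A.X (2 * n) n n c) (hcW : c ∈ weilClassesOf A φ n d) :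
    c ∈ algebraicClasses A.X n := by
  by_cases hc0 : c = 0
  · rw [hc0]; exact Submodule.zero_mem _
  obtain ⟨𝒳, S, f, hf, s, t, W, e₁, A₀, hWH, hread, ⟨e₀⟩, hA₀⟩ := hW d hd A φ hAdim hA hφ c hcQ hcH hcW hc0
  have h₀ : complexBetti.map (fiberι f t) (2 * n) W ∈ algebraicClasses (fiberOver f t) n :=
    Ring2Transport.mem_algebraicClasses_of_cmChart hCM A₀ e₀ (Andre1996.compactPencil_dim_eq_of_iso hf e₀) hA₀
      (hWH t).1 (hWH t).2
  have h₁ := hT f hf n W hWH t (mem_cmLocus_of_compactPencil hf e₀ hA₀) h₀ s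
  rw [← hread]
  exact (mem_algebraicClasses_map_iff_of_iso e₁).2 h₁

/-- **`HC_CM ∧ (∀ n ≥ 2, (W)ₙ) ∧ (∀ n ≥ 2, CMAnchoredTransportAtRelDim (2n)) ⟹ R∞`** (Weil's question for every
imaginary quadratic `K`): the transport-flavoured row at HALF the relative dimension of part IV. NO named fact.
[cite: Weil1977HodgeRing] [cite: Andre1996Motifs, §6.3 a) (p. 33)] -/
theorem HC_weilClassesImaginaryQuadratic_of_HC_CM_of_weilPencils_of_transport (hCM : RankFourFaces.CMAbelianHodge)
    (hW : ∀ n, 2 ≤ n → CMAnchoredCompactWeilPencilsAt n) (hT : ∀ n, 2 ≤ n → CMAnchoredTransportAtRelDim (2 * n)) :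
    WeilClassesImaginaryQuadratic :=
  fun n hn _ hd _ _ hAdim hA hφ _ hcQ hcH hcW ↦
    mem_algebraicClasses_of_HC_CM_of_weilPencilsAt_of_transport hCM (hW n hn) (hT n hn) hd hAdim hA hφ hcQ hcH hcW

/-- **`HC_CM ∧ (∀ n ≥ 2, (W)ₙ) ∧ (∀ n ≥ 2, FibreClassLefschetzAtRelDim (2n)) ⟹ R∞`** — the Lefschetz-flavoured row:
one algebraic correspondence per CM-pointed compact Weil pencil, inverting cup-with-the-fibre-class. NO named fact.
research route, not a corollary; conditional on HC_CM plus one named minimal statement.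
**ERRATUM: VACUOUS — the hypothesis `FibreClassLefschetzAtRelDim (2n)` is REFUTED-MISSTATED (part VIII
`not_fibreClassLefschetzAtRelDim_of_pencil`); SUPERSEDED by part IX's
`weilClassesImaginaryQuadratic_of_cmPowerWeilPencils_of_fibreClassLefschetzOn` / part VIII's repaired node.**
[cite: Abdulali1994FamiliesAV, Conjecture 5.3 (p. 1130)] [cite: Andre1996Motifs, Remarque 2 (p. 33)] -/
theorem HC_weilClassesImaginaryQuadratic_of_HC_CM_of_weilPencils_of_fibreClassLefschetz
    (hCM : RankFourFaces.CMAbelianHodge) (hW : ∀ n, 2 ≤ n → CMAnchoredCompactWeilPencilsAt n)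
    (hF : ∀ n, 2 ≤ n → FibreClassLefschetzAtRelDim (2 * n)) : WeilClassesImaginaryQuadratic :=
  HC_weilClassesImaginaryQuadratic_of_HC_CM_of_weilPencils_of_transport hCM hW
    fun n hn ↦ cmAnchoredTransportAtRelDim_of_fibreClassLefschetzAtRelDim (hF n hn)

/-- **THE SMALLEST OPEN INSTANCE as a kernel row: `HC_CM ∧ (W)₃ ∧ FibreClassLefschetzAtRelDim 6 ⟹ WeilSixfolds`**
(item stmt-HodgeConjecture-2524; Weil classes `W₆` on abelian sixfolds of Weil type, every `K = ℚ(√-d)`, every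
discriminant). The open Lefschetz-type content: for each compact CM-pointed pencil `𝒳⁷ → C` of Weil-type abelian
sixfolds, ONE algebraic cycle on the 14-fold `𝒳 × 𝒳` (codimension 6, acting `H⁸(𝒳) → H⁶(𝒳)`) inverting `∪[F]`
on fibre restrictions. Through Lemme 6.3.1 (part IV) the same classes cost the input at relative dimension 12.
Nothing here closes the item. research route, not a corollary; conditional on HC_CM plus one named minimal statement.
**ERRATUM: VACUOUS — the hypothesis `FibreClassLefschetzAtRelDim 6` is REFUTED-MISSTATED (part VIII
`not_fibreClassLefschetzAtRelDim_of_pencil`); SUPERSEDED by part VIII's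
`HC_weilSixfolds_of_HC_CM_of_weilPencilsAt_of_fibreClassLefschetzOnAtRelDim_six` and part IX's `HC_CM`-free
`weilSixfolds_of_cmPowerWeilPencilsAt_of_fibreClassLefschetzOnAtRelDim_six`.**
[cite: Abdulali1994FamiliesAV, Conjecture 5.3 (p. 1130) and Main Theorem 6.1 (b) (p. 1131)]
[cite: Andre1996Motifs, Lemme 6.3.1 (p. 31) and Remarque 2 (p. 33)] -/
theorem HC_weilSixfolds_of_HC_CM_of_weilPencilsAt_of_fibreClassLefschetzAtRelDim_six
    (hCM : RankFourFaces.CMAbelianHodge) (hW : CMAnchoredCompactWeilPencilsAt 3)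
    (hF : FibreClassLefschetzAtRelDim 6) : Theses.SevenfoldWeilCensus.WeilSixfolds :=
  weilSixfolds_iff_weilClassesOf.2 fun _ hd _ _ hAdim hA hφ _ hcQ hcH hcW ↦
    mem_algebraicClasses_of_HC_CM_of_weilPencilsAt_of_transport hCM hW
      (cmAnchoredTransportAtRelDim_of_fibreClassLefschetzAtRelDim hF) hd hAdim hA hφ hcQ hcH hcW

/-- The same with the transport input: `HC_CM ∧ (W)₃ ∧ CMAnchoredTransportAtRelDim 6 ⟹ WeilSixfolds`.
[cite: Andre1996Motifs, §6.3 a) (p. 33)] -/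
theorem HC_weilSixfolds_of_HC_CM_of_weilPencilsAt_of_cmAnchoredTransportAtRelDim_six
    (hCM : RankFourFaces.CMAbelianHodge) (hW : CMAnchoredCompactWeilPencilsAt 3)
    (hT : CMAnchoredTransportAtRelDim 6) : Theses.SevenfoldWeilCensus.WeilSixfolds :=
  weilSixfolds_iff_weilClassesOf.2 fun _ hd _ _ hAdim hA hφ _ hcQ hcH hcW ↦
    mem_algebraicClasses_of_HC_CM_of_weilPencilsAt_of_transport hCM hW hT hd hAdim hA hφ hcQ hcH hcW

/-- ON-PATH of the conclusions (the rows' targets are CASES of the summit; the habitat node (W) is not):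
`HodgeConjecture ⟹ WeilSixfolds` (tree) and `HodgeConjecture ⟹ FibreClassLefschetzAtRelDim d`-consequence
`CMAnchoredTransportAtRelDim d` (part IV). [folklore] -/
theorem weilSixfolds_and_transport_of_hodgeConjecture (h : _root_.HodgeConjecture) (d : ℕ) :
    Theses.SevenfoldWeilCensus.WeilSixfolds ∧ CMAnchoredTransportAtRelDim d :=
  ⟨WeilTypeLadder.weilSixfolds_of_hodgeConjecture h,
    fun _ _ f hf p W hW t ht h₀ s ↦ cmAnchoredTransport_of_hodgeConjecture h f hf p W hW t ht h₀ s⟩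

end Summit.HodgeConjecture.HodgeConjecture.Ring2.AbelianAll

end
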